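/-
Copyright: the b2b-balaban cell (near-miss cell 7), T⁴-continuum fan-out, NE7b formalisation swarm, leaf prover 05
(generation 2).  Released under the licence of the surrounding project.
-/
import Summits.QuantumFields.BalabanUV.T4Continuum.Support.HistoryJoinsAdm
import Summits.QuantumFields.BalabanUV.T4Continuum.Support.HistoryZoneMassJoins

/-!
# Row S6g′, binding part 10: ADDRESS TAGS — running a tag-keyed zone reading under the count's canonical admissibility

Summits-side support leaf of the T⁴-continuum cell (rung (B)+1 on a FINITE torus only; NOT infinite volume, NOT the
mass gap, NOT the Clay statement; NOT a proof of the spine estimate NE7b).  [folklore] finite tree bookkeeping over the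
swarm's OWN carrier (`Gen ε`, `HistoryJoins*`); nothing is quoted from print and nothing printed is asserted; no
`[cite:]` tag; no constants.

WHY.  The COUNT (`HistoryJoinsAdm.S`, `CAdm`) runs on the shape tree `G : Gen ε` — its symmetry classes are EQUAL
sub-structures, so equal-shape siblings must stay indistinguishable in `G`.  The zone-mass law of row (a)
(`HistoryZoneMassPiecesLaw`, `HistoryZoneMassBridge.hconn_of_cadm`, leaf-04 g3) reads zones through a TAG-keyed region
map and a part-zone function `Zf : ℕ → Gen ε → Finset β` — which can tell equal siblings apart only if their tags differ.
The bridge between the two is to tag every node of `G` by its GLOBAL ADDRESS: `addrTag a G : Gen (List Bool × ε)`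
(prefix `a`; a birth at address `l` of `G` is born with tag `(a ++ l, b)`), and to transport canonical admissibility
from `G` to `addrTag a G` (**`cadm_addrTag`**): the joins, parts, host and relative placements correspond index by index
(`croots_addrTag`, `part_addrTag`, `hostIdx_addrTag`), the contact forest transfers along the index bijection
(`forestAdm_comp_equiv`), and the `Sorted` half becomes VACUOUS (tagged parts are pairwise distinct:
`part_addrTag_injective`).  §4 supplies the part-zone function of the tagged tree, `Zf t W := zone t (untag W) (rel c₀
(pref W) P)` (`pref` = the address prefix read off the root tag), renewal-blind when `zone` is, with the identification
`hzone` of `hconn_of_cadm` PROVED (`zone_part_eq_zf`); §5 the invariance of the weight-side functionals (`bsum`,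
`partnerAges`, `nmerges`, `Dated`) under tagging.  The instance seat applies leaf-04 g3's bridge and law to
`addrTag [] G` with the region map `(l, b) ↦ region b (P l)`; the count itself stays on `G`.
HONEST DEPENDENCY (cell): continuum YM on T⁴ ⇐ BetaPertH ∧ nine spine estimates (0/9 proved); BetaPertH ⇐ (D1) ∧ (D4)
∧ CAP+tail.  This file changes none of it.
-/

open Finset
open Literature.MathematicalPhysics.QuantumFieldTheory.Balaban1983to89
open T4PersistenceDictionary T4PartnerMultiplicity T4BranchingRecordsGas
open Summit.QuantumFields.BalabanUV.T4Continuum.HistorySiblingSymmetry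
open Summit.QuantumFields.BalabanUV.T4Continuum.HistorySiblingCanon
open Summit.QuantumFields.BalabanUV.T4Continuum.HistoryJoins
open Summit.QuantumFields.BalabanUV.T4Continuum.HistoryJoinsAdm
open Summit.QuantumFields.BalabanUV.T4Continuum.HistoryZoneMassJoins

namespace Summit.QuantumFields.BalabanUV.T4Continuum.HistoryJoinsTag

variable {ε : Type*}

/-! ## §1 Address tags and the elementary transports -/

/-- **TAG EVERY NODE BY ITS GLOBAL ADDRESS** (prefix `a`): a birth at address `l` becomes `born (a ++ l, b) j`; events
are tagged by the address of their node. [folklore] -/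
def addrTag : List Bool → Gen ε → Gen (List Bool × ε)
  | a, Gen.born b j => Gen.born (a, b) j
  | a, Gen.renew G e h => Gen.renew (addrTag a G) (a, e) h
  | a, Gen.merge X Y e => Gen.merge (addrTag (a ++ [false]) X) (addrTag (a ++ [true]) Y) (a, e)

/-- tagging a birth [folklore] -/
@[simp] theorem addrTag_born (a : List Bool) (b : ε) (j : ℕ) : addrTag a (Gen.born b j) = Gen.born (a, b) j := rfl
/-- tagging a renewal [folklore] -/
@[simp] theorem addrTag_renew (a : List Bool) (G : Gen ε) (e : ε) (h : ℕ) :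
    addrTag a (Gen.renew G e h) = Gen.renew (addrTag a G) (a, e) h := rfl
/-- tagging a merger [folklore] -/
@[simp] theorem addrTag_merge (a : List Bool) (X Y : Gen ε) (e : ε) :
    addrTag a (Gen.merge X Y e) = Gen.merge (addrTag (a ++ [false]) X) (addrTag (a ++ [true]) Y) (a, e) := rfl

/-- **UNTAGGING** recovers the shape tree [folklore] -/
theorem untag_addrTag : ∀ (a : List Bool) (G : Gen ε), relabel Prod.snd (addrTag a G) = G
  | a, Gen.born b j => rfl
  | a, Gen.renew G e h => by simp [untag_addrTag a G]
  | a, Gen.merge X Y e => by simp [untag_addrTag _ X, untag_addrTag _ Y]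

/-- tagging keeps the root step [folklore] -/
@[simp] theorem rootStep_addrTag : ∀ (a : List Bool) (G : Gen ε), (addrTag a G).rootStep = G.rootStep
  | a, Gen.born b j => rfl
  | a, Gen.renew G e h => by simp [rootStep_addrTag a G]
  | a, Gen.merge X Y e => by simp [rootStep_addrTag _ X, rootStep_addrTag _ Y]

/-- tagging keeps the root address [folklore] -/
@[simp] theorem rootAddr_addrTag : ∀ (a : List Bool) (G : Gen ε), rootAddr (addrTag a G) = rootAddr G
  | a, Gen.born b j => rfl
  | a, Gen.renew G e h => by simp [rootAddr, rootAddr_addrTag a G]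
  | a, Gen.merge X Y e => by simp [rootAddr, rootAddr_addrTag _ X, rootAddr_addrTag _ Y]

/-- **THE ROOT TAG IS THE PREFIX FOLLOWED BY THE ROOT ADDRESS.** [folklore] -/
theorem root_addrTag : ∀ (a : List Bool) (G : Gen ε), (addrTag a G).root = (a ++ rootAddr G, G.root)
  | a, Gen.born b j => by simp [Gen.root, rootAddr]
  | a, Gen.renew G e h => by simp [Gen.root, rootAddr, root_addrTag a G]
  | a, Gen.merge X Y e => by
      simp only [addrTag_merge, Gen.root, rootStep_addrTag, root_addrTag _ X, root_addrTag _ Y, rootAddr]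
      split_ifs <;> simp

/-- tagging keeps the birth addresses [folklore] -/
@[simp] theorem baddr_addrTag : ∀ (a : List Bool) (G : Gen ε), baddr (addrTag a G) = baddr G
  | a, Gen.born b j => rfl
  | a, Gen.renew G e h => by simp [baddr, baddr_addrTag a G]
  | a, Gen.merge X Y e => by simp [baddr, baddr_addrTag _ X, baddr_addrTag _ Y]

/-- tagging keeps the size [folklore] -/
@[simp] theorem gsize_addrTag : ∀ (a : List Bool) (G : Gen ε), gsize (addrTag a G) = gsize G
  | a, Gen.born b j => rfl
  | a, Gen.renew G e h => by simp [gsize, gsize_addrTag a G]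
  | a, Gen.merge X Y e => by simp [gsize, gsize_addrTag _ X, gsize_addrTag _ Y]

/-- the tagging map on (address, part) pairs [folklore] -/
def tagq (a : List Bool) (q : List Bool × Gen ε) : List Bool × Gen (List Bool × ε) := (q.1, addrTag (a ++ q.1) q.2)

/-- first components are untouched [folklore] -/
@[simp] theorem tagq_fst (a : List Bool) (q : List Bool × Gen ε) : (tagq a q).1 = q.1 := rfl
/-- second components are tagged with the extended prefix [folklore] -/
@[simp] theorem tagq_snd (a : List Bool) (q : List Bool × Gen ε) : (tagq a q).2 = addrTag (a ++ q.1) q.2 := rfl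

variable (st : ε → ℕ)

/-- **CLUSTER PARTS OF THE TAGGED TREE** = the tagged cluster parts, same addresses. [folklore] -/
theorem clusterParts_addrTag (t : ℕ) : ∀ (a : List Bool) (G : Gen ε),
    clusterParts (st ∘ Prod.snd) t (addrTag a G) = (clusterParts st t G).map (tagq a)
  | a, Gen.born b j => by simp [tagq]
  | a, Gen.renew G e h => by simp [tagq]
  | a, Gen.merge X Y e => by
      by_cases he : st e = t
      · rw [addrTag_merge, clusterParts_merge_of_eq (st ∘ Prod.snd) (show (st ∘ Prod.snd) (a, e) = t from he),
          clusterParts_merge_of_eq st he, clusterParts_addrTag t _ X, clusterParts_addrTag t _ Y]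
        simp [tagq, List.map_map, Function.comp_def]
      · rw [addrTag_merge, clusterParts_merge_of_ne (st ∘ Prod.snd) (show (st ∘ Prod.snd) (a, e) ≠ t from he),
          clusterParts_merge_of_ne st he]
        simp [tagq]

/-- joins (with parent context) of the tagged tree [folklore] -/
theorem crootsP_addrTag : ∀ (p : Option ℕ) (a : List Bool) (G : Gen ε),
    crootsP (st ∘ Prod.snd) p (addrTag a G) = (crootsP st p G).map (tagq a)
  | p, a, Gen.born b j => by simp [crootsP]
  | p, a, Gen.renew G e h => by simpa [crootsP] using crootsP_addrTag none a G
  | p, a, Gen.merge X Y e => by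
      simp only [addrTag_merge, crootsP, Function.comp_apply, crootsP_addrTag _ _ X, crootsP_addrTag _ _ Y,
        List.map_append, List.map_map]
      congr 1
      · split_ifs <;> simp [tagq]
      · simp [tagq, Function.comp_def]

/-- **JOINS OF THE TAGGED TREE** = the tagged joins. [folklore] -/
theorem croots_addrTag (a : List Bool) (G : Gen ε) :
    croots (st ∘ Prod.snd) (addrTag a G) = (croots st G).map (tagq a) :=
  crootsP_addrTag st none a G

/-- top-join parts of the tagged tree [folklore] -/
theorem jparts_addrTag (a : List Bool) : ∀ G : Gen ε, jparts (st ∘ Prod.snd) (addrTag a G) = (jparts st G).map (tagq a)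
  | Gen.born b j => by simp [jparts]
  | Gen.renew G e h => by simp [jparts]
  | Gen.merge X Y e => by
      simp only [addrTag_merge, jparts, Function.comp_apply]
      exact clusterParts_addrTag st (st e) a (Gen.merge X Y e)

/-- same number of parts [folklore] -/
theorem npart_addrTag (a : List Bool) (G : Gen ε) : npart (st ∘ Prod.snd) (addrTag a G) = npart st G := by
  simp [npart, jparts_addrTag]

/-- **PART BY PART**: the `j`-th part of the tagged tree is the tagged `j`-th part. [folklore] -/
theorem part_addrTag (a : List Bool) (G : Gen ε) (j : Fin (npart (st ∘ Prod.snd) (addrTag a G))) :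
    part (st ∘ Prod.snd) (addrTag a G) j = tagq a (part st G (Fin.cast (npart_addrTag st a G) j)) := by
  unfold part
  rw [List.get_of_eq (jparts_addrTag st a G)]
  simp [List.getElem_map, Fin.cast]

/-! ## §2 Distinct addresses: parts are injective, the host is unique -/

/-- the cluster parts' addresses are pairwise distinct [folklore] -/
theorem pairwise_fst_ne_clusterParts (t : ℕ) :
    ∀ G : Gen ε, (clusterParts st t G).Pairwise fun q q' => q.1 ≠ q'.1
  | Gen.born b j => by simp
  | Gen.renew G e h => by simp
  | Gen.merge X Y e => by
      by_cases he : st e = t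
      · rw [clusterParts_merge_of_eq st he, List.pairwise_append]
        refine ⟨List.pairwise_map.2 ((pairwise_fst_ne_clusterParts t X).imp fun h => by simpa using h),
          List.pairwise_map.2 ((pairwise_fst_ne_clusterParts t Y).imp fun h => by simpa using h), ?_⟩
        intro q hq q' hq'
        obtain ⟨r, -, rfl⟩ := List.mem_map.1 hq
        obtain ⟨r', -, rfl⟩ := List.mem_map.1 hq'
        simp
      · rw [clusterParts_merge_of_ne st he]; simp

/-- the part list has no duplicates [folklore] -/
theorem nodup_jparts : ∀ G : Gen ε, (jparts st G).Nodup
  | Gen.born b j => by simp [jparts]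
  | Gen.renew G e h => by simp [jparts]
  | Gen.merge X Y e => by
      simp only [jparts]
      exact (pairwise_fst_ne_clusterParts st (st e) (Gen.merge X Y e)).imp fun h heq => h (by rw [heq])

/-- **PARTS ARE INJECTIVE IN THE INDEX.** [folklore] -/
theorem part_injective (G : Gen ε) : Function.Injective (part st G) := by
  intro i j h
  unfold part at h
  exact (List.nodup_iff_injective_get.1 (nodup_jparts st G)) h

/-- **THE HOST IS THE ONLY PART WHOSE ADDRESS PREFIXES THE ROOT ADDRESS.** [folklore] -/
theorem eq_hostIdx_of_prefix (X Y : Gen ε) (e : ε) {i : Fin (npart st (Gen.merge X Y e))} {r : List Bool}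
    (h : rootAddr (Gen.merge X Y e) = (part st _ i).1 ++ r) : i = hostIdx st X Y e := by
  have hh := rootAddr_eq_host st X Y e
  rw [h] at hh
  have := eq_of_append_eq st (st e) (Gen.merge X Y e) _ (part_mem st _ i) _ (part_mem st _ (hostIdx st X Y e)) _ _ hh
  exact part_injective st _ this.1

/-- **THE HOST INDEX OF THE TAGGED TREE IS THE HOST INDEX.** [folklore] -/
theorem hostIdx_addrTag (a : List Bool) (X Y : Gen ε) (e : ε) :
    Fin.cast (npart_addrTag st a (Gen.merge X Y e))
        (hostIdx (st ∘ Prod.snd) (addrTag (a ++ [false]) X) (addrTag (a ++ [true]) Y) (a, e)) =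
      hostIdx st X Y e := by
  set jh := hostIdx (st ∘ Prod.snd) (addrTag (a ++ [false]) X) (addrTag (a ++ [true]) Y) (a, e) with hjh
  have h : rootAddr (addrTag a (Gen.merge X Y e)) =
      (part (st ∘ Prod.snd) (addrTag a (Gen.merge X Y e)) jh).1 ++
        rootAddr (part (st ∘ Prod.snd) (addrTag a (Gen.merge X Y e)) jh).2 :=
    rootAddr_eq_host (st ∘ Prod.snd) (addrTag (a ++ [false]) X) (addrTag (a ++ [true]) Y) (a, e)
  have e1 : rootAddr (addrTag a (Gen.merge X Y e)) = rootAddr (Gen.merge X Y e) := rootAddr_addrTag a _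
  have e2 : (part (st ∘ Prod.snd) (addrTag a (Gen.merge X Y e)) jh).1 =
      (part st (Gen.merge X Y e) (Fin.cast (npart_addrTag st a (Gen.merge X Y e)) jh)).1 := by
    rw [part_addrTag]; rfl
  refine eq_hostIdx_of_prefix st X Y e (r := rootAddr (part (st ∘ Prod.snd) (addrTag a (Gen.merge X Y e)) jh).2) ?_
  rw [← e2, ← e1]
  exact h

/-- tagged parts are PAIRWISE DISTINCT (their root tags carry distinct addresses) [folklore] -/
theorem part_addrTag_injective (a : List Bool) (X Y : Gen ε) (e : ε)
    {i j : Fin (npart (st ∘ Prod.snd) (addrTag a (Gen.merge X Y e)))}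
    (h : (part (st ∘ Prod.snd) (addrTag a (Gen.merge X Y e)) i).2 =
      (part (st ∘ Prod.snd) (addrTag a (Gen.merge X Y e)) j).2) : i = j := by
  rw [part_addrTag, part_addrTag, tagq_snd, tagq_snd] at h
  have hr := congrArg (fun W => W.root.1) h
  simp only [root_addrTag, List.append_assoc] at hr
  have hr' := List.append_cancel_left hr
  have hq := eq_of_append_eq st (st e) (Gen.merge X Y e) _ (part_mem st _ _) _ (part_mem st _ _) _ _ hr'
  have hij := part_injective st _ hq.1
  exact Fin.cast_injective _ hij

/-! ## §3 Canonical admissibility transports to the tagged tree -/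

/-- forest admissibility transports along a bijection of the index types [folklore] -/
theorem forestAdm_comp_equiv {I J Pos : Type*} {ok : I → Pos → Prop} {touch : I → Pos → I → Pos → Prop} {h : I}
    {c : I → Pos} (hc : ForestAdm ok touch h c) (σ : J ≃ I) {ok' : J → Pos → Prop}
    {touch' : J → Pos → J → Pos → Prop} {h' : J} (hh : σ h' = h) (hok : ∀ j p, ok (σ j) p → ok' j p)
    (ht : ∀ j p k q, touch (σ j) p (σ k) q → touch' j p k q) : ForestAdm ok' touch' h' (c ∘ σ) := by
  obtain ⟨par, ⟨rk, hrk⟩, hpar⟩ := hc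
  have hne : ∀ j, j ≠ h' → σ j ≠ h := fun j hj heq => hj (σ.injective (heq.trans hh.symm))
  refine ⟨fun j => σ.symm (par (σ j)), ⟨fun j => rk (σ j), fun j hj => ?_⟩, fun j hj => ?_⟩
  · simpa using hrk (σ j) (hne j hj)
  · obtain ⟨h1, h2⟩ := hpar (σ j) (hne j hj)
    refine ⟨hok j _ h1, ht j _ _ _ ?_⟩
    simpa using h2

section Transfer

variable {γ β R : Type*} [DecidableEq β] [LinearOrder R] {D : ℕ}
  (zone : ℕ → Gen ε → (Addr D → γ) → Finset β) (ρ : (Addr D → γ) → R) (c₀ : γ)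

open scoped Classical

/-- **THE ZONE MAP OF THE TAGGED TREE**: read the untagged structure. [folklore] -/
def zoneT (t : ℕ) (W : Gen (List Bool × ε)) (p : Addr D → γ) : Finset β := zone t (relabel Prod.snd W) p

omit [DecidableEq β] in
/-- unfolding [folklore] -/
@[simp] theorem zoneT_apply (t : ℕ) (W : Gen (List Bool × ε)) (p : Addr D → γ) :
    zoneT zone t W p = zone t (relabel Prod.snd W) p := rfl

omit [DecidableEq β] [LinearOrder R] in
/-- the relative placements of the tagged top join are those of the join [folklore] -/
theorem cfg_addrTag (a : List Bool) (X Y : Gen ε) (e : ε) (P : Addr D → γ) :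
    cfg c₀ (st ∘ Prod.snd) (addrTag (a ++ [false]) X) (addrTag (a ++ [true]) Y) (a, e) P =
      cfg c₀ st X Y e P ∘ finCongr (npart_addrTag st a (Gen.merge X Y e)) := by
  funext j
  have ej := part_addrTag st a (Gen.merge X Y e) j
  simp only [addrTag_merge] at ej
  simp only [cfg, Function.comp_apply, finCongr_apply, ej, tagq_fst]
  rfl

/-- **THE LOCAL JOIN CONDITION TRANSPORTS**: forest by the index bijection, `Sorted` vacuously (tagged parts are pairwise
distinct). [folklore] -/
theorem localTop_addrTag (a : List Bool) (X Y : Gen ε) (e : ε) (P : Addr D → γ)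
    (h : LocalTop zone ρ c₀ st (Gen.merge X Y e) P) :
    LocalTop (zoneT zone) ρ c₀ (st ∘ Prod.snd) (addrTag a (Gen.merge X Y e)) P := by
  rw [addrTag_merge]
  refine ⟨?_, ?_⟩
  · -- the contact forest
    have hF := h.1
    rw [cfg_addrTag]
    refine forestAdm_comp_equiv hF (finCongr (npart_addrTag st a (Gen.merge X Y e))) ?_ (fun _ _ _ => trivial) ?_
    · rw [finCongr_apply]; exact hostIdx_addrTag st a X Y e
    · intro j p k q hjk
      have ej := part_addrTag st a (Gen.merge X Y e) j
      have ek := part_addrTag st a (Gen.merge X Y e) k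
      simp only [addrTag_merge] at ej ek
      simp only [touch0, zoneT_apply, Function.comp_apply, ej, ek, tagq_snd, untag_addrTag]
      exact hjk
  · -- sorted within classes: classes are singletons
    intro j k hkey hlt
    exfalso
    have hparts := part_eq_of_key_eq (st ∘ Prod.snd) _ _ _ hkey
    have hjk : j = k := by
      have := part_addrTag_injective st a X Y e (i := j) (j := k) (by simpa using hparts)
      exact this
    exact lt_irrefl _ (hjk ▸ hlt)

/-- **CANONICAL ADMISSIBILITY TRANSPORTS TO THE TAGGED TREE** (any prefix). [folklore] -/
theorem cadm_addrTag {G : Gen ε} {P : Addr D → γ} (hadm : CAdm zone ρ c₀ st G P) (a : List Bool) :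
    CAdm (zoneT zone) ρ c₀ (st ∘ Prod.snd) (addrTag a G) P := by
  intro q hq
  rw [croots_addrTag, List.mem_map] at hq
  obtain ⟨q₀, hq₀, rfl⟩ := hq
  obtain ⟨X, Y, e, hXY⟩ := exists_eq_merge_of_mem_crootsP st none G q₀ hq₀
  have h := hadm q₀ hq₀
  obtain ⟨l, W⟩ := q₀
  simp only at hXY
  subst hXY
  exact localTop_addrTag st zone ρ c₀ (a ++ l) X Y e (rel c₀ l P) h

/-! ## §4 The part-zone function of the tagged tree and the identification `hzone` -/

/-- **THE ADDRESS PREFIX OF A TAGGED STRUCTURE**, read off its root tag. [folklore] -/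
def pref (W : Gen (List Bool × ε)) : List Bool := (W.root).1.take ((W.root).1.length - (rootAddr W).length)

/-- the prefix of a tagged structure is its tagging prefix [folklore] -/
@[simp] theorem pref_addrTag (a : List Bool) (G : Gen ε) : pref (addrTag a G) = a := by
  simp [pref, root_addrTag, List.take_left']

/-- renewals keep the prefix [folklore] -/
@[simp] theorem pref_renew (W : Gen (List Bool × ε)) (r : List Bool × ε) (h : ℕ) :
    pref (Gen.renew W r h) = pref W := rfl

/-- **THE PART-ZONE FUNCTION**: the zone of the untagged structure under the GLOBAL placement shifted to its prefix — a
function of the tagged part alone. [folklore] -/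
def zf (P : Addr D → γ) (t : ℕ) (W : Gen (List Bool × ε)) : Finset β := zone t (relabel Prod.snd W) (rel c₀ (pref W) P)

omit [DecidableEq β] in
/-- the part-zone function is renewal-blind when the zone map is [folklore] -/
theorem zf_renew (hzr : ∀ (t : ℕ) (Y : Gen ε) (r : ε) (h : ℕ) (p : Addr D → γ), zone t (Gen.renew Y r h) p = zone t Y p)
    (P : Addr D → γ) (t : ℕ) (W : Gen (List Bool × ε)) (r : List Bool × ε) (h : ℕ) :
    zf zone c₀ P t (Gen.renew W r h) = zf zone c₀ P t W := by
  simp [zf, hzr]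

omit [DecidableEq β] in
/-- **THE IDENTIFICATION `hzone`** of `HistoryZoneMassBridge.hconn_of_cadm`, PROVED for the tagged tree: at every join
`q` of `addrTag [] G` and every part `i`, the zone the count displays (untagged part, relative placement composed along
the paths) IS `zf` of the tagged part. [folklore] -/
theorem zone_part_eq_zf (G : Gen ε) (P : Addr D → γ) :
    ∀ q ∈ croots (st ∘ Prod.snd) (addrTag [] G), ∀ (t : ℕ) (i : Fin (npart (st ∘ Prod.snd) q.2)),
      zoneT zone t (part (st ∘ Prod.snd) q.2 i).2 (rel c₀ (part (st ∘ Prod.snd) q.2 i).1 (rel c₀ q.1 P)) =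
        zf zone c₀ P t (part (st ∘ Prod.snd) q.2 i).2 := by
  intro q hq t i
  rw [croots_addrTag, List.mem_map] at hq
  obtain ⟨⟨l, W⟩, hq₀, rfl⟩ := hq
  have e1 : (tagq ([] : List Bool) (l, W)).2 = addrTag l W := by simp [tagq]
  have e0 : (tagq ([] : List Bool) (l, W)).1 = l := rfl
  -- rewrite the part through `part_addrTag`
  have key : ∀ (V : Gen (List Bool × ε)) (hV : V = addrTag l W) (j : Fin (npart (st ∘ Prod.snd) V)),
      zoneT zone t (part (st ∘ Prod.snd) V j).2 (rel c₀ (part (st ∘ Prod.snd) V j).1 (rel c₀ l P)) =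
        zf zone c₀ P t (part (st ∘ Prod.snd) V j).2 := by
    intro V hV j
    subst hV
    rw [part_addrTag]
    simp [zf, tagq, untag_addrTag, rel_append]
  simpa [e0] using key _ e1 i

end Transfer

/-! ## §5 The weight-side functionals are blind to the tags -/

/-- `bsum` [folklore] -/
@[simp] theorem bsum_addrTag (f : ε → ℝ) : ∀ (a : List Bool) (G : Gen ε), bsum (f ∘ Prod.snd) (addrTag a G) = bsum f G
  | a, Gen.born b j => rfl
  | a, Gen.renew G e h => by simp [bsum, bsum_addrTag f a G]
  | a, Gen.merge X Y e => by simp [bsum, bsum_addrTag f _ X, bsum_addrTag f _ Y]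

/-- `partnerAges` [folklore] -/
@[simp] theorem partnerAges_addrTag : ∀ (a : List Bool) (G : Gen ε),
    partnerAges (st ∘ Prod.snd) (addrTag a G) = partnerAges st G
  | a, Gen.born b j => rfl
  | a, Gen.renew G e h => by simp [partnerAges, partnerAges_addrTag a G]
  | a, Gen.merge X Y e => by simp [partnerAges, partnerAges_addrTag _ X, partnerAges_addrTag _ Y]

/-- `nmerges` [folklore] -/
@[simp] theorem nmerges_addrTag : ∀ (a : List Bool) (G : Gen ε), nmerges (addrTag a G) = nmerges G
  | a, Gen.born b j => rfl
  | a, Gen.renew G e h => by simp [nmerges_addrTag a G]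
  | a, Gen.merge X Y e => by simp [nmerges_addrTag _ X, nmerges_addrTag _ Y]

/-- `Dated` [folklore] -/
theorem dated_addrTag : ∀ (s : Bool) (t : ℕ) (a : List Bool) (G : Gen ε),
    Dated (st ∘ Prod.snd) s t (addrTag a G) ↔ Dated st s t G
  | s, t, a, Gen.born b j => by simp
  | s, t, a, Gen.renew G e h => by simp [dated_addrTag true t a G]
  | s, t, a, Gen.merge X Y e => by
      simp only [addrTag_merge, dated_merge, Function.comp_apply, dated_addrTag false _ _ X, dated_addrTag false _ _ Y]

end Summit.QuantumFields.BalabanUV.T4Continuum.HistoryJoinsTag
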